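import Summits.BirchSwinnertonDyer.BirchSwinnertonDyer.Theorems.Rank1ResidualJetLocalTransverse
import Summits.BirchSwinnertonDyer.BirchSwinnertonDyer.Theorems.Rank1ResidualJetRowDualityPrep
import HarnessLib

/-!
# The walk's transverse family, GLOBAL form: one Selmer structure `𝒯` on `E[n]/K` carrying Jetchev's
# intrinsic transverse condition at EVERY finite place, and its agreement with bsd-jet's per-conductor
# families (cell `bsd-stepL`, seat `bsd-stepL-tam3-p1`, helper toward item 19109 `EulerHalvesAtThree`,
# registered stub `stub_supplyAtThree`)

HONEST FRAMING. Nothing here proves BSD, J₃ or any divisibility of a Heegner point; no stub is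
discharged; no item closes; 0 classes move (T7); `--supports stmt-BirchSwinnertonDyer-19109` (helper).

WHAT THIS FILE DOES. The supply stub `stub_supplyAtThree` of `Cruxes/EulerHalvesAtThree/Lines/birth.lean`
asks for ONE transverse family `𝒯` (a `SelmerStructure` on `E[3^k]/K`) used at every admissible
conductor `s` through `selmerF W (3^k) 𝒯 (placesDividing K s)`; bsd-jet's road-K bricks
(`exists_localTransverseFamily`, p509971; the END-FORM local facts `h𝒯σ`, `h𝒯sd` of
`jetchevDivisibilityCarrierMult_of_localFacts`, p517079) are phrased for the per-conductor family
`𝒯_c(v) = ⨅_{ℓ ∣ c, ℓ ∈ v} ⨅_{w' ∣ v} ker(H¹(K_v, E[n]) → H¹(K[ℓ]_{w'}, E[n]))`. Here: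
* `exists_globalTransverseFamily` — the family `𝒯(v) = ⨅_{ℓ prime, ℓ ∈ v} ⨅_{w' ∣ v} ker(…)`
  (`⊤` at the infinite places): since a finite place contains exactly ONE rational prime
  (`prime_eq_of_natCast_mem`), at a place `v ∣ c` (square-free `c`) it AGREES with `𝒯_c(v)`
  (`globalTransverse_eq_of_mem_placesDividing`);
* consequently the reconciliation with lit-ty's `transverseKer` (`globalTransverse_mem_iff`), and the
  TRANSFER of the two END-FORM local facts from `𝒯_c` to `𝒯` at the places dividing `c`
  (`globalTransverse_conjActPlace_mem`, `globalTransverse_dualTransported_eq`) — the inputs `h𝒯σ`,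
  `h𝒯sd` of this seat's `Walk.exists_dualityConjuncts_of_rowDuality` (p516936) for the global family;
* the supply's conjunct `hdisj` ([J] §4.2: `H¹_f(K_λ) ∩ H¹_tr(K_λ) = 0` at a Kolyvagin `λ`) for the
  global family FROM the same statement about one completion (`globalTransverse_disjoint_kummer`;
  the local statement is a hypothesis — print-to-type, [J] §4.2 / [MR04] Lemma 1.2.4).
References (locators only; no cited FACT is declared): [cite: Jetchev2008, §3.1.2 (p. 814), §3.4.1
(p. 816), §4.2] [cite: MazurRubin2004, Def. 1.1.6, Lemma 1.2.4] [cite: Rubin2011, Def. 1.9.4].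
Design: no definitions (the family is delivered by an `∃`); `K : Type`. Axioms: `propext`,
`Classical.choice`, `Quot.sound`.
-/

set_option autoImplicit false

noncomputable section

open scoped Classical Pointwise
open Function NumberField IsDedekindDomain WeierstrassCurve Field
open Literature.NumberTheory.EllipticCurves Literature.NumberTheory.GaloisRepresentations
open Literature.NumberTheory.EllipticCurves.Jetchev2008
open Literature.NumberTheory.GaloisCohomology Literature.NumberTheory.Automorphic
open Literature.NumberTheory.GaloisRepresentations.DiscreteGaloisModule (transverseSubgroup SelmerStructure)
open Summit.BirchSwinnertonDyer.Rank1Residual.JET.SelmerVocabulary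

namespace Summit.BirchSwinnertonDyer.Rank1Residual.JET.Walk

variable {K : Type} [Field K] [NumberField K] (W : WeierstrassCurve ℚ)

/-! ### A finite place contains exactly one rational prime -/

omit [NumberField K] in
/-- Two rational primes in the same prime of `𝓞 K` are equal (distinct primes are coprime).
[folklore] -/
theorem prime_eq_of_natCast_mem (v : HeightOneSpectrum (𝓞 K)) {ℓ ℓ' : ℕ} (hℓ : ℓ.Prime)
    (hℓ' : ℓ'.Prime) (hv : (ℓ : 𝓞 K) ∈ v.asIdeal) (hv' : (ℓ' : 𝓞 K) ∈ v.asIdeal) : ℓ = ℓ' := by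
  by_contra hne
  exact Literature.NumberTheory.NumberFields.Honda1971.natCast_notMem_of_coprime
    ((Nat.coprime_primes hℓ hℓ').mpr hne) v hv hv'

/-- Every finite place of a number field contains a rational prime (the characteristic of its
residue field). [folklore] -/
theorem exists_prime_natCast_mem (v : HeightOneSpectrum (𝓞 K)) :
    ∃ ℓ : ℕ, ℓ.Prime ∧ (ℓ : 𝓞 K) ∈ v.asIdeal := by
  have hN : ((Ideal.absNorm v.asIdeal : ℕ) : 𝓞 K) ∈ v.asIdeal := Ideal.absNorm_mem _
  have hN0 : Ideal.absNorm v.asIdeal ≠ 0 := fun h ↦ v.ne_bot (Ideal.absNorm_eq_zero_iff.mp h)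
  obtain ⟨ℓ, hℓ, hℓv⟩ := (natCast_mem_iff_exists_primeFactor_mem hN0 v).mp hN
  exact ⟨ℓ, Nat.prime_of_mem_primeFactors hℓ, hℓv⟩

/-! ### The global intrinsic transverse family -/

/-- **The GLOBAL intrinsic transverse family**: a Selmer structure `𝒯` on `E[n]/K` with, at every
finite place `v`, `𝒯_v = ⨅_{ℓ prime, ℓ ∈ v} ⨅_{w' ∣ v} ker(H¹(K_v, E[n]) → H¹(K[ℓ]_{w'}, E[n]))`
(Jetchev's `H¹_tr(K_λ, E[p^m])` at the prime `λ` over `ℓ`, rendered by the tree's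
`transverseSubgroup` along `K_v → K[ℓ]_{w'}` as in bsd-jet's `exists_localTransverseFamily`), and
`⊤` at the infinite places. [cite: Jetchev2008, §3.1.2 (p. 814)] [cite: Rubin2011, Def. 1.9.4] -/
theorem exists_globalTransverseFamily (ι : K →+* ℂ) (n : ℤ)
    [∀ k : ℕ, NumberField (ringClassField K ι k)] :
    ∃ 𝒯 : SelmerStructure ((W.baseChange K).torsionGaloisModule n),
      (∀ v : HeightOneSpectrum (𝓞 K), 𝒯 (Sum.inr v) =
        ⨅ (ℓ : ℕ) (_ : ℓ.Prime ∧ (ℓ : 𝓞 K) ∈ v.asIdeal),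
          ⨅ (w' : HeightOneSpectrum (𝓞 (ringClassField K ι ℓ)))
            (_ : w'.asIdeal.LiesOver v.asIdeal),
            letI := (adicCompletionOfLiesOver K (ringClassField K ι ℓ) v w').toAlgebra
            transverseSubgroup (GaloisRep.toLocal v ((W.baseChange K).torsionGaloisModule n))
              (w'.adicCompletion (ringClassField K ι ℓ))) ∧
      ∀ w : InfinitePlace K, 𝒯 (Sum.inl w) = ⊤ := by
  refine ⟨fun v ↦ match v with
    | Sum.inl _ => ⊤
    | Sum.inr v => ⨅ (ℓ : ℕ) (_ : ℓ.Prime ∧ (ℓ : 𝓞 K) ∈ v.asIdeal),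
          ⨅ (w' : HeightOneSpectrum (𝓞 (ringClassField K ι ℓ)))
            (_ : w'.asIdeal.LiesOver v.asIdeal),
            letI := (adicCompletionOfLiesOver K (ringClassField K ι ℓ) v w').toAlgebra
            transverseSubgroup (GaloisRep.toLocal v ((W.baseChange K).torsionGaloisModule n))
              (w'.adicCompletion (ringClassField K ι ℓ)), fun v ↦ rfl, fun w ↦ rfl⟩

variable {W}
variable {ι : K →+* ℂ} {n : ℤ} [∀ k : ℕ, NumberField (ringClassField K ι k)]
  {𝒯 : SelmerStructure ((W.baseChange K).torsionGaloisModule n)}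
  (h𝒯 : ∀ v : HeightOneSpectrum (𝓞 K), 𝒯 (Sum.inr v) =
    ⨅ (ℓ : ℕ) (_ : ℓ.Prime ∧ (ℓ : 𝓞 K) ∈ v.asIdeal),
      ⨅ (w' : HeightOneSpectrum (𝓞 (ringClassField K ι ℓ)))
        (_ : w'.asIdeal.LiesOver v.asIdeal),
        letI := (adicCompletionOfLiesOver K (ringClassField K ι ℓ) v w').toAlgebra
        transverseSubgroup (GaloisRep.toLocal v ((W.baseChange K).torsionGaloisModule n))
          (w'.adicCompletion (ringClassField K ι ℓ)))

include h𝒯 in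
/-- **At a place over the prime `ℓ`, the global family is the `K[ℓ]`-transverse condition**:
`𝒯_v = ⨅_{w' ∣ v} ker(H¹(K_v, E[n]) → H¹(K[ℓ]_{w'}, E[n]))` (the only rational prime in `v` is `ℓ`).
[cite: Jetchev2008, §3.1.2 (p. 814)] -/
theorem globalTransverse_eq_of_natCast_mem (v : HeightOneSpectrum (𝓞 K)) {ℓ : ℕ} (hℓ : ℓ.Prime)
    (hv : (ℓ : 𝓞 K) ∈ v.asIdeal) :
    𝒯 (Sum.inr v) = ⨅ (w' : HeightOneSpectrum (𝓞 (ringClassField K ι ℓ)))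
        (_ : w'.asIdeal.LiesOver v.asIdeal),
        letI := (adicCompletionOfLiesOver K (ringClassField K ι ℓ) v w').toAlgebra
        transverseSubgroup (GaloisRep.toLocal v ((W.baseChange K).torsionGaloisModule n))
          (w'.adicCompletion (ringClassField K ι ℓ)) := by
  rw [h𝒯 v]
  apply le_antisymm
  · exact (iInf_le _ ℓ).trans (iInf_le _ ⟨hℓ, hv⟩)
  · refine le_iInf fun ℓ' ↦ le_iInf fun hℓ' ↦ ?_
    obtain rfl : ℓ = ℓ' := prime_eq_of_natCast_mem v hℓ hℓ'.1 hv hℓ'.2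
    exact le_rfl

include h𝒯 in
/-- **Agreement with bsd-jet's per-conductor family at the places dividing the conductor**: for a
square-free `c` and a family `𝒯c` with `𝒯c_v = ⨅_{ℓ ∣ c, ℓ ∈ v} ⨅_{w' ∣ v} ker(…)` (the shape of
`exists_localTransverseFamily` and of the END-FORM local facts), `𝒯_v = 𝒯c_v` at every `v ∣ c`.
[cite: Jetchev2008, §3.1.2 (p. 814), §3.4.1 (p. 816)] -/
theorem globalTransverse_eq_of_mem_placesDividing {c : ℕ} (hc : Squarefree c)
    {𝒯c : SelmerStructure ((W.baseChange K).torsionGaloisModule n)}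
    (h𝒯c : ∀ v : HeightOneSpectrum (𝓞 K), 𝒯c (Sum.inr v) =
      ⨅ ℓ ∈ c.primeFactors.filter (fun ℓ : ℕ ↦ ((ℓ : ℕ) : 𝓞 K) ∈ v.asIdeal),
        ⨅ (w' : HeightOneSpectrum (𝓞 (ringClassField K ι ℓ))) (_ : w'.asIdeal.LiesOver v.asIdeal),
          letI := (adicCompletionOfLiesOver K (ringClassField K ι ℓ) v w').toAlgebra
          transverseSubgroup (GaloisRep.toLocal v ((W.baseChange K).torsionGaloisModule n))
            (w'.adicCompletion (ringClassField K ι ℓ)))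
    (v : HeightOneSpectrum (𝓞 K)) (hv : v ∈ placesDividing K c) :
    𝒯 (Sum.inr v) = 𝒯c (Sum.inr v) := by
  have hc0 : c ≠ 0 := hc.ne_zero
  obtain ⟨ℓ₀, hℓ₀, hℓ₀v⟩ := (natCast_mem_iff_exists_primeFactor_mem hc0 v).mp
    ((mem_placesDividing_iff_natCast_mem hc0 v).mp hv)
  have hℓ₀p : ℓ₀.Prime := Nat.prime_of_mem_primeFactors hℓ₀
  rw [globalTransverse_eq_of_natCast_mem h𝒯 v hℓ₀p hℓ₀v, h𝒯c v]
  apply le_antisymm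
  · refine le_iInf fun ℓ' ↦ le_iInf fun hℓ' ↦ ?_
    rw [Finset.mem_filter] at hℓ'
    obtain rfl : ℓ₀ = ℓ' :=
      prime_eq_of_natCast_mem v hℓ₀p (Nat.prime_of_mem_primeFactors hℓ'.1) hℓ₀v hℓ'.2
    exact le_rfl
  · exact (iInf_le _ ℓ₀).trans (iInf_le _ (Finset.mem_filter.mpr ⟨hℓ₀, hℓ₀v⟩))

include h𝒯 in
/-- **Reconciliation with lit-ty's global rendering** (the hypothesis `hT` of bsd-jet's H63 line, for
the global family): for a square-free `c` and `x ∈ H¹(K, E[n])`, `loc_w x ∈ 𝒯_w` for all `w ∣ c` iff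
`x ∈ transverseKer ℓ` for every prime `ℓ ∣ c`. [cite: Jetchev2008, §3.1.2 (p. 814), §3.4.1 (p. 816)] -/
theorem globalTransverse_mem_iff {c : ℕ} (hc : Squarefree c)
    (x : galoisCohomology ((W.baseChange K).torsionGaloisModule n) 1) :
    (∀ w ∈ placesDividing K c,
      galoisCohomology.localization ((W.baseChange K).torsionGaloisModule n) (Sum.inr w) 1 x ∈
        𝒯 (Sum.inr w)) ↔
    ∀ ℓ ∈ c.primeFactors, x ∈ transverseKer W K ι n ℓ := by
  obtain ⟨𝒯c, h𝒯c, hT⟩ := exists_localTransverseFamily W ι n hc.ne_zero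
  rw [← hT x]
  refine forall₂_congr fun w hw ↦ ?_
  rw [globalTransverse_eq_of_mem_placesDividing h𝒯 hc h𝒯c w hw]

/-! ### Transfer of the END-FORM local facts to the global family -/

section Transfer

variable (τ : K ≃ₐ[ℚ] K)

include h𝒯 in
/-- **`τ`-stability of the global family at the places dividing a square-free conductor**, FROM the
same statement for the per-conductor family (bsd-jet END-FORM local fact `h𝒯σ`, Gross §3 dihedral).
[cite: Jetchev2008, §3.1.2 (p. 814)] [cite: GrossLMS1991, §3] -/
theorem globalTransverse_conjActPlace_mem {c : ℕ} (hc : Squarefree c)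
    (h𝒯σc : ∀ (𝒯c : SelmerStructure ((W.baseChange K).torsionGaloisModule n)),
      (∀ v : HeightOneSpectrum (𝓞 K), 𝒯c (Sum.inr v) =
        ⨅ ℓ ∈ c.primeFactors.filter (fun ℓ : ℕ ↦ ((ℓ : ℕ) : 𝓞 K) ∈ v.asIdeal),
          ⨅ (w' : HeightOneSpectrum (𝓞 (ringClassField K ι ℓ))) (_ : w'.asIdeal.LiesOver v.asIdeal),
            letI := (adicCompletionOfLiesOver K (ringClassField K ι ℓ) v w').toAlgebra
            transverseSubgroup (GaloisRep.toLocal v ((W.baseChange K).torsionGaloisModule n))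
              (w'.adicCompletion (ringClassField K ι ℓ))) →
      ∀ (v w : HeightOneSpectrum (𝓞 K)) (h : τ • v = w), v ∈ placesDividing K c →
      ∀ x : galoisCohomology (((W.baseChange K).torsionGaloisModule n).toLocal (Sum.inr v : Place K)) 1,
      x ∈ 𝒯c (Sum.inr v) → conjActPlace W τ n h x ∈ 𝒯c (Sum.inr w))
    (v w : HeightOneSpectrum (𝓞 K)) (h : τ • v = w) (hv : v ∈ placesDividing K c)
    (x : galoisCohomology (((W.baseChange K).torsionGaloisModule n).toLocal (Sum.inr v : Place K)) 1)
    (hx : x ∈ 𝒯 (Sum.inr v)) : conjActPlace W τ n h x ∈ 𝒯 (Sum.inr w) := by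
  obtain ⟨𝒯c, h𝒯c, -⟩ := exists_localTransverseFamily W ι n hc.ne_zero
  have hw : w ∈ placesDividing K c := by
    rw [← h, GlobalDuality.smul_mem_placesDividing_iff τ hc.ne_zero]; exact hv
  rw [globalTransverse_eq_of_mem_placesDividing h𝒯 hc h𝒯c w hw]
  rw [globalTransverse_eq_of_mem_placesDividing h𝒯 hc h𝒯c v hv] at hx
  exact h𝒯σc 𝒯c h𝒯c v w h hv x hx

variable {N : ℕ} [NeZero N]
  {e : geomTorsion (W.baseChange K) N → geomTorsion (W.baseChange K) N → AlgebraicClosure K}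
  {hμ : ∀ S T, e S T ^ N = 1}
  {hadd₁ : ∀ S₁ S₂ T, e (S₁ + S₂) T = e S₁ T * e S₂ T}
  {hadd₂ : ∀ S T₁ T₂, e S (T₁ + T₂) = e S T₁ * e S T₂}
  {hgal : ∀ (g : absoluteGaloisGroup K) (S T : geomTorsion (W.baseChange K) N),
    g • e S T = e (g • S) (g • T)}

/-- **Self-duality of the global family at the places dividing a square-free conductor**, FROM the
same statement for the per-conductor family (bsd-jet END-FORM local fact `h𝒯sd`, Howard 2004
Prop. 2.1.9 (ii)): the transported dual at a place depends only on the local condition there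
(`GlobalDuality.dualTransported_congr`). [cite: Howard2004HeegnerKolyvagin, Prop. 2.1.9 (ii)]
[cite: Jetchev2008, §3.1.2 (p. 814)] -/
theorem globalTransverse_dualTransported_eq [(W.baseChange K).IsElliptic]
    [Finite (geomTorsion (W.baseChange K) N)]
    {𝒯' : SelmerStructure ((W.baseChange K).torsionGaloisModule N)}
    (h𝒯' : ∀ v : HeightOneSpectrum (𝓞 K), 𝒯' (Sum.inr v) =
      ⨅ (ℓ : ℕ) (_ : ℓ.Prime ∧ (ℓ : 𝓞 K) ∈ v.asIdeal),
        ⨅ (w' : HeightOneSpectrum (𝓞 (ringClassField K ι ℓ)))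
          (_ : w'.asIdeal.LiesOver v.asIdeal),
          letI := (adicCompletionOfLiesOver K (ringClassField K ι ℓ) v w').toAlgebra
          transverseSubgroup (GaloisRep.toLocal v ((W.baseChange K).torsionGaloisModule N))
            (w'.adicCompletion (ringClassField K ι ℓ)))
    {c : ℕ} (hc : Squarefree c)
    (h𝒯sdc : ∀ (𝒯c : SelmerStructure ((W.baseChange K).torsionGaloisModule N)),
      (∀ v : HeightOneSpectrum (𝓞 K), 𝒯c (Sum.inr v) =
        ⨅ ℓ ∈ c.primeFactors.filter (fun ℓ : ℕ ↦ ((ℓ : ℕ) : 𝓞 K) ∈ v.asIdeal),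
          ⨅ (w' : HeightOneSpectrum (𝓞 (ringClassField K ι ℓ))) (_ : w'.asIdeal.LiesOver v.asIdeal),
            letI := (adicCompletionOfLiesOver K (ringClassField K ι ℓ) v w').toAlgebra
            transverseSubgroup (GaloisRep.toLocal v ((W.baseChange K).torsionGaloisModule N))
              (w'.adicCompletion (ringClassField K ι ℓ))) →
      ∀ inv : LocalInvariants K N, inv.IsPerfect → ∀ v ∈ placesDividing K c,
      inv.dualTransported 𝒯c (weilDualIntertwining (W.baseChange K) N e hμ hadd₁ hadd₂ hgal)
        (Sum.inr v) = 𝒯c (Sum.inr v))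
    (inv : LocalInvariants K N) (hperf : inv.IsPerfect)
    (v : HeightOneSpectrum (𝓞 K)) (hv : v ∈ placesDividing K c) :
    inv.dualTransported 𝒯' (weilDualIntertwining (W.baseChange K) N e hμ hadd₁ hadd₂ hgal)
        (Sum.inr v) = 𝒯' (Sum.inr v) := by
  obtain ⟨𝒯c, h𝒯c, -⟩ := exists_localTransverseFamily W ι (N : ℤ) hc.ne_zero
  have heq : 𝒯' (Sum.inr v) = 𝒯c (Sum.inr v) :=
    globalTransverse_eq_of_mem_placesDividing h𝒯' hc h𝒯c v hv
  rw [GlobalDuality.dualTransported_congr W N e hμ hadd₁ hadd₂ hgal inv heq, heq]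
  exact h𝒯sdc 𝒯c h𝒯c inv hperf v hv

end Transfer

/-! ### `hdisj`: the Kummer and transverse conditions are disjoint at a Kolyvagin prime -/

include h𝒯 in
/-- **The supply's `hdisj` for the global family** ([J] §4.2: `H¹_f(K_λ, E[p^k]) ∩ H¹_tr(K_λ, E[p^k]) = 0`
at the prime `λ` over a Kolyvagin prime `ℓ`), FROM the same statement about ONE completion (the
intrinsic `K[ℓ]`-transverse condition at `λ`; a print-to-type local input, [MR04] Lemma 1.2.4).
[cite: Jetchev2008, §4.2 (p. 818)] [cite: MazurRubin2004, Lemma 1.2.4] -/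
theorem globalTransverse_disjoint_kummer {P : ℕ → Prop}
    (htrf : ∀ ℓ : ℕ, P ℓ → ∀ v : HeightOneSpectrum (𝓞 K), (ℓ : 𝓞 K) ∈ v.asIdeal →
      Disjoint ((W.baseChange K).kummerSelmerStructure n (Sum.inr v))
        (⨅ (w' : HeightOneSpectrum (𝓞 (ringClassField K ι ℓ)))
          (_ : w'.asIdeal.LiesOver v.asIdeal),
          letI := (adicCompletionOfLiesOver K (ringClassField K ι ℓ) v w').toAlgebra
          transverseSubgroup (GaloisRep.toLocal v ((W.baseChange K).torsionGaloisModule n))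
            (w'.adicCompletion (ringClassField K ι ℓ))))
    (hP : ∀ ℓ, P ℓ → ℓ.Prime)
    (ℓ : ℕ) (hℓ : P ℓ) (v : HeightOneSpectrum (𝓞 K)) (hv : (ℓ : 𝓞 K) ∈ v.asIdeal) :
    Disjoint ((W.baseChange K).kummerSelmerStructure n (Sum.inr v)) (𝒯 (Sum.inr v)) := by
  rw [globalTransverse_eq_of_natCast_mem h𝒯 v (hP ℓ hℓ) hv]
  exact htrf ℓ hℓ v hv

end Summit.BirchSwinnertonDyer.Rank1Residual.JET.Walk

end
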